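import Mathlib
import Summits.Ventures.PercRepro2.MeasureBridgeProb
import Summits.Ventures.PercRepro2.CylinderCond

/-!
# The edge split: conditioning on the status of one edge is pinning, and the law of total
covariance over one edge (blind cell PercRepro2, typer-1 g18; a language line)

`Defs.lean`'s pinning identity `weight p ω = p e · weight (p[e↦1]) ω + (1 − p e) · weight (p[e↦0]) ω`
(`weight_eq_pin`) says that conditioning on the status of an edge is re-weighting with that edge
pinned, on the same configuration space.  This file states it at the level of Mathlib's measures
and draws the covariance consequence:

* `cond_percMeasureOf_openEdge` / `cond_percMeasureOf_closedEdge`: for `p e ≠ 0` (resp. `p e ≠ 1`),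
  `(percMeasureOf p hp)[|openEdge e] = percMeasureOf (p[e↦1])` and
  `(percMeasureOf p hp)[|closedEdge e] = percMeasureOf (p[e↦0])`;
* `integral_cond_openEdge` / `integral_cond_closedEdge`: `∫ f ∂μ[|e open] = E_{p[e↦1]} f` and
  `∫ f ∂μ[|e closed] = E_{p[e↦0]} f`;
* `covariance_percMeasureOf`: `cov[f, g; percMeasureOf p hp] = E_p[f g] − E_p f · E_p g`;
* **`expect_mul_sub_mul_eq_pin`** / **`covariance_eq_pin`** (the edge split — the law of total
  covariance over the status of `e`): for every weight vector, edge `e` and `f, g`,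
  `cov[f, g; μ_p] = p e · cov[f, g; μ_{p[e↦1]}] + (1 − p e) · cov[f, g; μ_{p[e↦0]}]
     + p e (1 − p e) (E_{p[e↦1]} f − E_{p[e↦0]} f) (E_{p[e↦1]} g − E_{p[e↦0]} g)`
  — the within part (the two pinned covariances, weighted) plus the between part (the two-point
  covariance of the pinned means); in the `expect` language over any commutative ring and in
  Mathlib's covariance on the cell's measures;
* `covariance_eq_cond_openEdge_add_cond_closedEdge`: the same with the conditioned measures
  `μ[|openEdge e]`, `μ[|closedEdge e]` and their integrals (for `0 < p e < 1`);
* `cond_percMeasureOf_cylinder` / `integral_cond_cylinder`: the general exploration step — for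
  `P_p(cyl F σ) ≠ 0`, `(percMeasureOf p hp)[|cylinder F σ] = percMeasureOf (condWeights p F σ)`
  (p1's `CylinderCond.condWeights`: the explored edges of `F` pinned to the states of `σ`) — the
  domain Markov property at Mathlib's measure level; `openEdge e` is the case `F = {e}`.

Identities only; nothing about the sign of any term.
-/

namespace Summit.Ventures.PercRepro2

open MeasureTheory ProbabilityTheory MeasureBridge

namespace EdgeSplit

/-! ## The `expect` language, over any commutative ring -/

section Ring

variable {E : Type*} [Fintype E] [DecidableEq E] {R : Type*} [CommRing R]

/-- The probability of an event intersected with a singleton is the indicator of the event at that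
configuration times its weight. -/
lemma prob_inter_singleton (p : E → R) (A : Set (Config E)) (ω : Config E) :
    prob p (A ∩ {ω}) = A.indicator (weight p) ω := by
  classical
  unfold prob
  rw [Finset.sum_eq_single ω]
  · by_cases h : ω ∈ A <;> simp [h]
  · intro ω' _ hne
    simp [hne]
  · intro h
    exact absurd (Finset.mem_univ ω) h

/-- **The edge split in the `expect` language**: the covariance `E_p[f g] − E_p f · E_p g` is the
weighted sum of the two pinned covariances plus the two-point covariance of the pinned means. -/
theorem expect_mul_sub_mul_eq_pin (p : E → R) (e : E) (f g : Config E → R) :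
    expect p (fun ω => f ω * g ω) - expect p f * expect p g =
      p e * (expect (Function.update p e 1) (fun ω => f ω * g ω)
          - expect (Function.update p e 1) f * expect (Function.update p e 1) g)
      + (1 - p e) * (expect (Function.update p e 0) (fun ω => f ω * g ω)
          - expect (Function.update p e 0) f * expect (Function.update p e 0) g)
      + p e * (1 - p e) * (expect (Function.update p e 1) f - expect (Function.update p e 0) f)
          * (expect (Function.update p e 1) g - expect (Function.update p e 0) g) := by
  rw [expect_eq_pin p (fun ω => f ω * g ω) e, expect_eq_pin p f e, expect_eq_pin p g e]
  ring

end Ring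

/-! ## Mathlib's measures: conditioning on the status of an edge is pinning -/

section Measure

variable {E : Type*} [Fintype E] [DecidableEq E]

/-- On `{e open}` the weight pinned open is the weight divided by `p e`. -/
lemma weight_update_one_of_eq_true (p : E → ℝ) {e : E} (he : p e ≠ 0) {ω : Config E}
    (h : ω e = true) : weight (Function.update p e 1) ω = (p e)⁻¹ * weight p ω := by
  have hpin := weight_eq_pin p ω e
  rw [weight_update_zero_of_eq_true p h, mul_zero, add_zero] at hpin
  rw [hpin, ← mul_assoc, inv_mul_cancel₀ he, one_mul]

/-- On `{e closed}` the weight pinned closed is the weight divided by `1 − p e`. -/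
lemma weight_update_zero_of_eq_false (p : E → ℝ) {e : E} (he : 1 - p e ≠ 0) {ω : Config E}
    (h : ω e = false) : weight (Function.update p e 0) ω = (1 - p e)⁻¹ * weight p ω := by
  have hpin := weight_eq_pin p ω e
  rw [weight_update_one_of_eq_false p h, mul_zero, zero_add] at hpin
  rw [hpin, ← mul_assoc, inv_mul_cancel₀ he, one_mul]

/-- **Conditioning on `{e open}` is pinning `e` open**: for `p e ≠ 0`,
`(percMeasureOf p hp)[|openEdge e] = percMeasureOf (p[e↦1])`. -/
theorem cond_percMeasureOf_openEdge (p : E → ℝ) (hp : IsProbVec p) {e : E} (he : p e ≠ 0) :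
    (percMeasureOf p hp)[|openEdge e] =
      percMeasureOf (Function.update p e 1) (hp.update e zero_le_one le_rfl) := by
  refine Measure.ext_of_measureReal_singleton fun ω => ?_
  rw [measureReal_def, cond_apply MeasurableSet.of_discrete, ENNReal.toReal_mul, ENNReal.toReal_inv,
    ← measureReal_def, ← measureReal_def, percMeasureOf_real_apply, percMeasureOf_real_apply,
    prob_openEdge, prob_inter_singleton, percMeasureOf_real_singleton]
  by_cases h : ω e = true
  · rw [Set.indicator_of_mem (show ω ∈ openEdge e from h), weight_update_one_of_eq_true p he h]
  · simp only [Bool.not_eq_true] at h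
    rw [Set.indicator_of_notMem (show ω ∉ openEdge e from by simp [openEdge, h]), mul_zero,
      weight_update_one_of_eq_false p h]

/-- **Conditioning on `{e closed}` is pinning `e` closed**: for `p e ≠ 1`,
`(percMeasureOf p hp)[|closedEdge e] = percMeasureOf (p[e↦0])`. -/
theorem cond_percMeasureOf_closedEdge (p : E → ℝ) (hp : IsProbVec p) {e : E} (he : p e ≠ 1) :
    (percMeasureOf p hp)[|closedEdge e] =
      percMeasureOf (Function.update p e 0) (hp.update e le_rfl zero_le_one) := by
  have he' : 1 - p e ≠ 0 := sub_ne_zero.mpr (Ne.symm he)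
  refine Measure.ext_of_measureReal_singleton fun ω => ?_
  rw [measureReal_def, cond_apply MeasurableSet.of_discrete, ENNReal.toReal_mul, ENNReal.toReal_inv,
    ← measureReal_def, ← measureReal_def, percMeasureOf_real_apply, percMeasureOf_real_apply,
    prob_closedEdge, prob_inter_singleton, percMeasureOf_real_singleton]
  by_cases h : ω e = true
  · rw [Set.indicator_of_notMem (show ω ∉ closedEdge e from by simp [closedEdge, h]), mul_zero,
      weight_update_zero_of_eq_true p h]
  · simp only [Bool.not_eq_true] at h
    rw [Set.indicator_of_mem (show ω ∈ closedEdge e from h), weight_update_zero_of_eq_false p he' h]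

/-- `∫ f ∂μ[|e open] = E_{p[e↦1]} f` for `p e ≠ 0`. -/
theorem integral_cond_openEdge (p : E → ℝ) (hp : IsProbVec p) {e : E} (he : p e ≠ 0)
    (f : Config E → ℝ) :
    ∫ ω, f ω ∂((percMeasureOf p hp)[|openEdge e]) = expect (Function.update p e 1) f := by
  rw [cond_percMeasureOf_openEdge p hp he, integral_percMeasureOf]

/-- `∫ f ∂μ[|e closed] = E_{p[e↦0]} f` for `p e ≠ 1`. -/
theorem integral_cond_closedEdge (p : E → ℝ) (hp : IsProbVec p) {e : E} (he : p e ≠ 1)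
    (f : Config E → ℝ) :
    ∫ ω, f ω ∂((percMeasureOf p hp)[|closedEdge e]) = expect (Function.update p e 0) f := by
  rw [cond_percMeasureOf_closedEdge p hp he, integral_percMeasureOf]

/-- The covariance under the product Bernoulli measure as finite sums:
`cov[f, g; percMeasureOf p hp] = E_p[f g] − E_p f · E_p g`. -/
theorem covariance_percMeasureOf (p : E → ℝ) (hp : IsProbVec p) (f g : Config E → ℝ) :
    cov[f, g; percMeasureOf p hp] = expect p (fun ω => f ω * g ω) - expect p f * expect p g := by
  rw [covariance_eq_sub MemLp.of_discrete MemLp.of_discrete, integral_percMeasureOf,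
    integral_percMeasureOf, integral_percMeasureOf]
  rfl

/-- **The edge split = the law of total covariance over the status of `e`**, on Mathlib's measures:
for every weight vector `p`, edge `e` and `f, g`,
`cov[f, g; μ_p] = p e · cov[f, g; μ_{p[e↦1]}] + (1 − p e) · cov[f, g; μ_{p[e↦0]}]
  + p e (1 − p e) (E_{p[e↦1]} f − E_{p[e↦0]} f) (E_{p[e↦1]} g − E_{p[e↦0]} g)`. -/
theorem covariance_eq_pin (p : E → ℝ) (hp : IsProbVec p) (e : E) (f g : Config E → ℝ) :
    cov[f, g; percMeasureOf p hp] =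
      p e * cov[f, g; percMeasureOf (Function.update p e 1) (hp.update e zero_le_one le_rfl)]
      + (1 - p e) * cov[f, g; percMeasureOf (Function.update p e 0) (hp.update e le_rfl zero_le_one)]
      + p e * (1 - p e) * (expect (Function.update p e 1) f - expect (Function.update p e 0) f)
          * (expect (Function.update p e 1) g - expect (Function.update p e 0) g) := by
  rw [covariance_percMeasureOf, covariance_percMeasureOf, covariance_percMeasureOf]
  exact expect_mul_sub_mul_eq_pin p e f g

/-- The edge split with the conditioned measures (`0 < p e < 1`):
`cov[f, g; μ] = p e · cov[f, g; μ[|e open]] + (1 − p e) · cov[f, g; μ[|e closed]]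
  + p e (1 − p e) (μ[|e open] f − μ[|e closed] f) (μ[|e open] g − μ[|e closed] g)`. -/
theorem covariance_eq_cond_openEdge_add_cond_closedEdge (p : E → ℝ) (hp : IsProbVec p) {e : E}
    (he0 : p e ≠ 0) (he1 : p e ≠ 1) (f g : Config E → ℝ) :
    cov[f, g; percMeasureOf p hp] =
      p e * cov[f, g; (percMeasureOf p hp)[|openEdge e]]
      + (1 - p e) * cov[f, g; (percMeasureOf p hp)[|closedEdge e]]
      + p e * (1 - p e)
          * ((∫ ω, f ω ∂((percMeasureOf p hp)[|openEdge e]))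
              - ∫ ω, f ω ∂((percMeasureOf p hp)[|closedEdge e]))
          * ((∫ ω, g ω ∂((percMeasureOf p hp)[|openEdge e]))
              - ∫ ω, g ω ∂((percMeasureOf p hp)[|closedEdge e])) := by
  rw [cond_percMeasureOf_openEdge p hp he0, cond_percMeasureOf_closedEdge p hp he1,
    integral_percMeasureOf, integral_percMeasureOf, integral_percMeasureOf, integral_percMeasureOf]
  exact covariance_eq_pin p hp e f g

/-- **Conditioning on a cylinder is pinning the explored edges** — the domain Markov property at
Mathlib's measure level: for `P_p(cyl F σ) ≠ 0`,
`(percMeasureOf p hp)[|cylinder F σ] = percMeasureOf (condWeights p F σ)` (the edges of `F` forced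
into the states of `σ`, the others unchanged; `CylinderCond.weight_condWeights` pointwise). -/
theorem cond_percMeasureOf_cylinder (p : E → ℝ) (hp : IsProbVec p) (F : Finset E) (σ : Config E)
    (hF : prob p (cylinder F σ) ≠ 0) :
    (percMeasureOf p hp)[|cylinder F σ] =
      percMeasureOf (CylinderCond.condWeights p F σ) (CylinderCond.isProbVec_condWeights hp F σ) := by
  refine Measure.ext_of_measureReal_singleton fun ω => ?_
  rw [measureReal_def, cond_apply MeasurableSet.of_discrete, ENNReal.toReal_mul, ENNReal.toReal_inv,
    ← measureReal_def, ← measureReal_def, percMeasureOf_real_apply, percMeasureOf_real_apply,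
    prob_inter_singleton, percMeasureOf_real_singleton, CylinderCond.weight_condWeights,
    ← mul_assoc, inv_mul_cancel₀ hF, one_mul]

/-- `∫ f ∂μ[|cyl F σ] = E_{condWeights p F σ} f` for `P_p(cyl F σ) ≠ 0`. -/
theorem integral_cond_cylinder (p : E → ℝ) (hp : IsProbVec p) (F : Finset E) (σ : Config E)
    (hF : prob p (cylinder F σ) ≠ 0) (f : Config E → ℝ) :
    ∫ ω, f ω ∂((percMeasureOf p hp)[|cylinder F σ]) = expect (CylinderCond.condWeights p F σ) f := by
  rw [cond_percMeasureOf_cylinder p hp F σ hF, integral_percMeasureOf]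

end Measure

end EdgeSplit

end Summit.Ventures.PercRepro2
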